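import Literature.MathematicalPhysics.QuantumFieldTheory.Balaban1983to89.B10Eq71Concrete
import Literature.MathematicalPhysics.QuantumFieldTheory.Balaban1983to89.B10LargeField

/-!
# `Balaban1983to89.B10Eq71AllPlaquettes` — [Balaban1985UV3] p. 273, after **(71)**: *"We get these small factors for all
# plaquettes in all large fields set P"* — THE OVERLAP OF THE REGIONS `Δ′(p′)`: at one scale every fine plaquette lies in at most
# FOUR of them, so (71) holds for ALL large-field plaquettes of a scale SIMULTANEOUSLY with the explicit share `c₁ = ¼` of the action

T. Bałaban, *Ultraviolet stability of three-dimensional lattice pure gauge field theories*, Commun. Math. Phys. **102**, 255–275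
(1985) [Balaban1985UV3] (cell paper B10; held `paper:balaban1985-cmp102-uv-stability-3d`, journal page = PDF page + 254; p. 273 =
[PDF 19] re-read 2026-08-23 on the text layer `p0019.txt`/`p0020.txt` and, for the displays, on the render
`run/shared/lean/pub/pub-balaban/b2b-balaban-ref1/pages/1985-cmp102-uv-stability-3d/…-p019-x2.png` as recorded in `B10Eq70Squaring`);
T. Bałaban, *Averaging operations for lattice gauge theories*, Commun. Math. Phys. **98**, 17–51 (1985) [Balaban1985Averaging] (= B10's
reference [4]; (2) p. 17 the blocks `B^k(y)`, (42)–(43) the `j`-fold average).  «…» = verbatim.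

HONEST FRAMING (mega-formalization `lit-balaban`, verbatim): statement-level skeleton of published theorems with citation tags; proofs
where landed; nothing here is a claim about the Yang–Mills mass gap.

## The printed text (p. 273 [PDF 19], continuing on p. 274 [PDF 20])

«This inequality can be written finally as
(1/g_k²) Σ_{p⊂Δ′} η⁻¹[1 − Re tr U_k(∂p)] ≥ (1/2g_j²)|V_j(∂p′) − 1|² − O(1)g_jp³(g_j) ≥ ½p²(g_j) − O(1)g_jp³(g_j) ≥ ¼p²(g_j)  (71)
for g_j sufficiently small. Thus the part of the action 1/g_k²A^η(U_k) localized to the sum of four j-blocks Δ′ connected with the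
plaquette p′ can be bounded from below by 1/4p²(g_j), and the corresponding part of the exponential gives the small factor
exp(−1/4p²(g_j)). We get these small factors for all plaquettes in all large fields set P. Results related to stability bound (70) have
been obtained by P. Federbush in [17, 18]. The analysis of Sect. 3.C [9], which is model independent, show that these small factors are
enough to control all sums in (41), together with the second term in (65). This gives the upper bound in (5).»  with (70) p. 273
«where Δ′ = B^j(x₀) ∪ B^j(y₀) ∪ B^j(z₀) ∪ B^j(w₀)» for «p′ = ⟨x₀, y₀, z₀, w₀⟩», and p. 273 before (67) «Let us take a plaquette
p′ ⊂ Λ_j and such that |V_j(∂p′) − 1| ≥ g_jp(g_j).»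

## Why this file exists (unit `lit-balaban-r07`, reader/typer and fold owner of B10; gen 55; rows B10.Eq70 / B10.Eq71, members)

(71) — PROVED in `B10Eq70Squaring` (this unit, gen 6: `ineq71`, `smallFactor_of_largeField`, `exp_localized_le`) and knitted with the
concrete (69) in `B10Eq71Concrete` — bounds, for ONE large-field plaquette `p′`, the part of the main action localized in `Δ′(p′)` from
below by `¼p²(g_j)`.  The sentence «We get these small factors for all plaquettes in all large fields set P» then USES all these lower
bounds AT ONCE against the ONE action `(1/g_k²)A^η(U_k)` — legitimate only because every plaquette term `η⁻¹[1 − Re tr U_k(∂p)]` is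
`≥ 0` AND the regions `Δ′(p′)` of distinct `p′` overlap with bounded multiplicity.  Print does not say this; the cell recorded it as the
unprinted point GAPS G-B10-10(a) («They are not disjoint (adjacent p′ share corner blocks), but the multiplicity is bounded … what (71)
yields simultaneously is mainT ≥ c₁Σ_{p′}¼p²(g_j) with an absolute c₁ … typed with c₁ explicit (`SmallFactorsAll`)»), and the
resummation module `B10LargeFieldSum` consumes exactly that shape as its verbatim leaf `SmallFactorsAll X c₁ g̃`.  THIS FILE MAKES THE
SINGLE-SCALE HALF OF THAT POINT A KERNEL THEOREM on the concrete `ℤ^d` geometry where (70)/(71) are proved (`B10Eq70Squaring.deltaBox`,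
fine plaquettes parallel to `p′` indexed by their lower-left corner `y`, the level-`j` plaquette `p′` at `z₀` with fine corner `x₀ = L^j z₀`):

* §1 **the overlap**: writing `q(y) = ⌊y/L^j⌋` (coordinatewise) for the level-`j` site whose block `B^j(q)` contains `y` (`mem_block_ediv`),
  `y ∈ Δ′(p′) ⟺ B^j(q(y))` is one of the four corner blocks of `p′` `⟺ z₀ ∈ {q, q − e_μ, q − e_ν, q − e_μ − e_ν}`
  (`mem_deltaBox_smul_iff`, print's «Δ′ = B^j(x₀) ∪ B^j(y₀) ∪ B^j(z₀) ∪ B^j(w₀)» read from the fine plaquette); hence **every fine plaquette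
  parallel to `p′` lies in `Δ′(p′)` for AT MOST 4 level-`j` plaquettes `p′` of that orientation** (`card_filter_mem_deltaBox_le`; sharp,
  `overlap_four_attained`);
* §2 the bookkeeping of bounded overlap (any family of regions `R_i ⊆ Y` with multiplicity `≤ m` at every point of `Y` and `G ≥ 0`):
  `Σ_i Σ_{y∈R_i} G(y) ≤ m·Σ_{y∈Y} G(y)` (`sum_sum_le_mul_of_overlap`), and the transfer of per-region lower bounds `w_i ≤ c·Σ_{R_i} act` to the
  simultaneous bound `Σ_i w_i ≤ m·c·Σ_Y act` (`sum_le_mul_of_local_bounds`);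
* §3 **(71) FOR ALL LARGE-FIELD PLAQUETTES OF ONE SCALE SIMULTANEOUSLY** (`d = 3`, one orientation `μ ≠ ν`, any finite family `S` of
  level-`j` positions `z₀`, any finite set `Y` of fine corners containing the regions, `act ≥ 0` on `Y`): from the per-plaquette (71)
  `¼p² ≤ (1/g_k²)·L^k·Σ_{p⊂Δ′(p′)} act(p)` for each `p′ ∈ S` — **`¼·Σ_{p′∈S} ¼p²(g_j) ≤ (1/g_k²)·L^k·Σ_{p∈Y} act(p)`**
  (`quarter_sum_le_of_local71`), i.e. the shape of `B10LargeFieldSum.SmallFactorsAll` at one scale with `c₁ = ¼`; with the hypotheses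
  (67), (68), (69), (11), «g_j sufficiently small» of `B10Eq70Squaring.smallFactor_of_largeField` assumed for every `p′ ∈ S`
  (`smallFactors_sameScale`), in cardinality form `|S|·p²(g_j)/16 ≤ …` and as the surviving small factor
  `exp[−(1/g_k²)L^kΣ_{Y}act] ≤ exp(−|S|·p²(g_j)/16) = (Π_{p′∈S} e^{−¼p²(g_j)})^{1/4}` (`exp_action_le_prod_smallFactors_quarter`);
* §3b THE PAPER'S GROUPS, END TO END: for a `U(N)`-valued (`card_smallFactors_unitaryGroup`) or `SU(N)`-valued
  (`card_smallFactors_specialUnitary`, the semi-simple case of Theorem 1) fine configuration `U` on `ℤ³` satisfying (68) in the form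
  `sup_p|U(∂p) − 1| < α₀L^{−2j}` with the Prop.-2 smallness of [4], and ANY finite family `S` of level-`j` plaquettes that are large-field
  plaquettes of the CONCRETE `j`-fold average `Ū^j` ((67) definitional; (69) by p29's `B10Eq69Concrete` through `B10Eq71Concrete`; (11) by
  `B10Eq11Trace`): **`|S|·p²(g_j)/16 ≤ (1/g_k²)·L^k·Σ_{p∈Y} N(1 − Re tr U(∂p))`** — no (67)/(69)/(11) hypothesis left;
* §4 all orientations at once (the fine plaquettes of different orientations are different terms of `A^η`; `c₁ = ¼` is unchanged:
  `quarter_sum_le_of_local71_orient`), and several scales with the total multiplicity `m` as an explicit hypothesis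
  (`inv_mul_sum_le_of_local71_multiscale`);
* §4b **ACROSS SCALES**: under the two inclusions that (38) p. 266 and the p. 268 rule give on the fine lattice — the corner blocks of
  `p′ ∈ P_j ⊂ Λ_j = Ω_j ∖ Ω_{j+1}` lie outside `Ω_{j+1}` (`hout`), the regions of later scales `j′ > j` lie inside `Ω_{j′} ⊆ Ω_{j+1}` (`hin`) — the
  regions of DIFFERENT scales are DISJOINT, so every fine plaquette lies in at most 4 regions over ALL scales (`card_filter_scales_le`) and
  **`¼·Σ_{(j,p′)} ¼p²(g_j) ≤ (1/g_k²)·η⁻¹·Σ_{p∈Y} act(p)`** with the ABSOLUTE `c₁ = ¼` (`quarter_sum_le_of_local71_scales`,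
  `smallFactorsAll_shape_scales` in `B10.pFun`'s letters) — sharper than the cell note's «≤ 3 adjacent scales … c₁ ≥ 1/36».

* §4c (v1.1, APPEND-ONLY — §1–§5 byte-identical except one quotation in the docstring of `card_filter_scales_le` (p. 268 «Λ_k = …»: v1 had typed «:=» and the locator «(48)», print has «=» in the sentence introducing (48)); + `import …B10LargeField`) **THE TWO INCLUSIONS FROM THE CELL'S TYPED RULE OF p. 268**:
  for a `B10LargeField.DomainSeq` on the fine lattice (`Pt := Site d`; `Ω j`, `P j`, block distance `bdist j`, `collar j = R(g_j)M₁ ≥ 0`)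
  satisfying `B10LargeField.Rule268` («Ω_{k+1}^{(k)} … with distances to P ∪ Ω_k^{(k)c} greater than R(g_k)M₁»), `hout` follows from
  `B10LargeField.collar_subset_Z` once every point of `Δ′_j(p′)` is within block distance `≤ R(g_j)M₁` of a point of `P_j` (`hadj` — the four corner
  blocks are ADJACENT to `p′ ∈ P_j`, p. 273 «the sum of four j-blocks Δ′ connected with the plaquette p′»), and `hin` from (38)
  (`nested38_of_rule268`, `Z_mono_le`) once `Δ′_{j′}(p″) ⊆ Ω_{j′}` (`hΩ` — p. 268 (the sentences introducing (48)) «Λ_{k+1} = Ω_{k+1}^{(k+1)}, hence Ω_{k+1}^{(k)} = B(Λ_{k+1})»: the blocks of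
  `Λ_{j′} ∋ p″` lie in `Ω_{j′}`): `not_mem_succ_of_rule268`, `mem_succ_of_rule268`, `card_filter_scales_le_of_rule268`, and
  **`quarter_sum_le_of_local71_rule268`** — `c₁ = ¼` under the cell's `Rule268` and the two adjacency readings.

DICTIONARY print ↦ Lean (that of `B10Eq70Squaring`, `d = 3` in §3): fine lattice `T_η` ↦ `Site 3 = ℤ³` (lower-left corners `y` of fine
plaquettes of the orientation `μ, ν`); level-`j` plaquette `p′` ↦ its position `z₀ : Site 3` (fine corner `x₀ = (L^j : ℕ) • z₀`); `Δ′(p′)` ↦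
`deltaBox (L^j) ((L^j : ℕ) • z₀) μ ν`; the large-field plaquettes of scale `j` (of this orientation) ↦ a `Finset` `S` of positions; the
plaquette terms `η⁻¹[1 − Re tr U_k(∂p)]` ↦ `L^k · act y` with `act ≥ 0` (for `U(N)`: `act = N(1 − Re tr U(∂p))`, `B10Eq70Squaring` §6); the
part of `A^η` over a finite region `Y ⊇ ⋃_{p′∈S} Δ′(p′)` ↦ `Σ_{y∈Y} act y` (any larger finite region only strengthens the conclusions);
`g_k² = g_j²L^{k−j}`, `p = p(g_j)`.

HONEST SCOPE. (i) One scale `j` at a time: the multiplicity `4` (per orientation) is exact for the reading «p ⊂ Δ′» = "fine plaquette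
parallel to `p′` with lower-left corner in `Δ′`" of `B10Eq70Squaring` (the reading for which (70) line 2 is proved there); reading
«p ⊂ Δ′» as all fine plaquettes inside the union of the four blocks changes only constants (a level-`j` site is a corner of 12 level-`j`
plaquettes in `d = 3`), and (71) holds a fortiori for any larger plaquette set.  (ii) ACROSS SCALES the regions `Δ′(p′)`, `p′ ∈ P_j`, and
`Δ′(p″)`, `p″ ∈ P_{j′}`, compete for the same action; the cell's note G-B10-10(a) argues from (39) that only `≤ 3` adjacent scales can meet.
§4b derives MORE (no two scales meet, `c₁ = ¼` absolute) from two inclusions `hout`/`hin` between the regions and the fine-site sets `D_j` of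
`Ω_{j+1}`; these inclusions are the READING of (38) p. 266, (48) and the rule of p. 268 («distances to P ∪ Ω_k^{(k)c} greater than R(g_k)M₁»)
on the fine lattice and enter as HYPOTHESES — the sets `D_j` are NOT constructed here from the torus domains of `B10Eq38TorusDomains` (where (38)
and the rule are kernel theorems: `nested38_ruleSeq`, `ruleDom`), and an instantiation of `B10LargeFieldSum.HistModel`/`SmallFactorsAll` from the
true (41) is not attempted (cell GAPS G-B10-10, «what would discharge them»); v1.1 §4c reduces `hout`/`hin` to the cell's typed rule
`B10LargeField.Rule268` plus the two adjacency readings `hadj`/`hΩ`, which remain hypotheses.  (iii) Nothing of [Balaban1985UV3] beyond the quoted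
sentences is asserted; (71) itself enters BY NAME (`B10Eq70Squaring.smallFactor_of_largeField`) or as the hypothesis `h71`.

WHAT THIS FILE PROVES (kernel, no `sorry`; THEOREMS ONLY — no definitions, no structures, no named facts; axioms standard; imports `B10Eq71Concrete` (hence `B10Eq70Squaring`, `B10Eq69Concrete`, `B10Eq11Trace`) BY NAME, byte-identical).  Value = SKELETON rows B10.Eq70/B10.Eq71 gain the member "for all plaquettes … simultaneously" with the
overlap constant explicit — at one scale unconditionally, across scales under the (38)/p.268 inclusions — (cell GAPS G-B10-10(a) in the kernel modulo the reading of the domain geometry); NOT summit progress.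
-/

noncomputable section

open scoped BigOperators
open Finset

namespace Literature.MathematicalPhysics.QuantumFieldTheory.Balaban1983to89.B10Eq71AllPlaquettes

open B7Prop1Explicit B7Prop2Explicit B10Eq70Squaring

-- the `ℤ^d` sites of `B7Prop1Explicit` (the torus `Site` of `Setup.lean` would otherwise be found first)
export B7Prop1Explicit (Site)

/-! ## §1 The overlap of the regions `Δ′(p′)` at one scale -/

section Overlap

variable {d : ℕ}

/-- Floor-division window of width one: for `0 < n`, `0 ≤ a − nz < n ⟺ z = ⌊a/n⌋` (`ℤ`-division `a / n` rounds down for positive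
`n`).  (bookkeeping of the block geometry (2) of [Balaban1985Averaging] — which block contains a given fine site — no content of the series)
[cite: Balaban1985Averaging, (2) p.17] -/
theorem window_one_iff {a z n : ℤ} (hn : 0 < n) : (0 ≤ a - n * z ∧ a - n * z < n) ↔ z = a / n := by
  constructor
  · rintro ⟨h0, hlt⟩
    have hz : z ≤ a / n := (Int.le_ediv_iff_mul_le hn).mpr (by linarith)
    have hz' : a / n < z + 1 := (Int.ediv_lt_iff_lt_mul hn).mpr (by linarith)
    omega
  · rintro rfl
    have h1 := Int.emod_def a n
    have h2 := Int.emod_nonneg a hn.ne'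
    have h3 := Int.emod_lt_of_pos a hn
    constructor <;> linarith

/-- Floor-division window of width two: for `0 < n`, `0 ≤ a − nz < 2n ⟺ z ∈ {⌊a/n⌋, ⌊a/n⌋ − 1}`.  (bookkeeping of the block geometry (2)
of [Balaban1985Averaging], no content of the series) [cite: Balaban1985Averaging, (2) p.17] -/
theorem window_two_iff {a z n : ℤ} (hn : 0 < n) :
    (0 ≤ a - n * z ∧ a - n * z < 2 * n) ↔ (z = a / n ∨ z = a / n - 1) := by
  constructor
  · rintro ⟨h0, hlt⟩
    have hz : z ≤ a / n := (Int.le_ediv_iff_mul_le hn).mpr (by linarith)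
    have hz' : a / n < z + 2 := (Int.ediv_lt_iff_lt_mul hn).mpr (by linarith)
    omega
  · intro h
    have h1 := Int.emod_def a n
    have h2 := Int.emod_nonneg a hn.ne'
    have h3 := Int.emod_lt_of_pos a hn
    rcases h with rfl | rfl
    · constructor <;> linarith
    · constructor <;> nlinarith

variable (n : ℕ) (μ ν : Fin d)

/-- Coordinates of the fine corner `n • z` of the level-`j` site `z` (`x₀ = L^j z₀` in `B10Eq70Squaring`'s dictionary). (bookkeeping of (2)
of [Balaban1985Averaging], no content of the series) [cite: Balaban1985Averaging, (2) p.17] -/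
theorem nsmul_site_apply (z : Site d) (κ : Fin d) : (n • z) κ = (n : ℤ) * z κ := by
  rw [Pi.smul_apply, nsmul_eq_mul]

/-- **Every fine site lies in the block over its base site** `q(y) = (⌊y_κ/n⌋)_κ` (`n = L^j`; the `x ∈ T^{(j)}`, corner convention of [4] (2)
with `x₀ = L^j x`, such that `y ∈ B^j(x)`): `y ∈ B^j(L^j·q(y))` — the blocks partition the fine lattice. [cite: Balaban1985Averaging, (2) p.17] -/
theorem mem_block_ediv (hn : 1 ≤ n) (y : Site d) : y ∈ B10Eq70Squaring.block n (n • fun κ => y κ / n) := by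
  rw [B10Eq70Squaring.mem_block]
  intro κ
  have hn' : (0 : ℤ) < n := by exact_mod_cast hn
  have h := (window_one_iff (a := y κ) (z := y κ / n) hn').mpr rfl
  simpa [Pi.sub_apply, nsmul_site_apply] using h

/-- **`y ∈ Δ′(p′)` read from the fine plaquette** (`p′` the level-`j` plaquette at `z₀` spanned by `e_μ, e_ν`, `μ ≠ ν`, fine corner
`x₀ = L^j z₀`; print p. 273 «Δ′ = B^j(x₀) ∪ B^j(y₀) ∪ B^j(z₀) ∪ B^j(w₀)»): the block of `y` is one of the four corner blocks of `p′`, i.e.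
`z₀` agrees with `q(y)` off the directions `μ, ν` and `z₀_μ ∈ {q(y)_μ, q(y)_μ − 1}`, `z₀_ν ∈ {q(y)_ν, q(y)_ν − 1}`.
[cite: Balaban1985UV3, (70) p.273] -/
theorem mem_deltaBox_smul_iff (hn : 1 ≤ n) (hμν : μ ≠ ν) (y z₀ : Site d) :
    y ∈ deltaBox n (n • z₀) μ ν ↔
      (∀ κ, κ ≠ μ → κ ≠ ν → z₀ κ = y κ / n) ∧ (z₀ μ = y μ / n ∨ z₀ μ = y μ / n - 1) ∧
        (z₀ ν = y ν / n ∨ z₀ ν = y ν / n - 1) := by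
  have hn' : (0 : ℤ) < n := by exact_mod_cast hn
  rw [mem_deltaBox]
  simp only [Pi.sub_apply, nsmul_site_apply]
  constructor
  · intro h
    refine ⟨fun κ hκμ hκν => ?_, ?_, ?_⟩
    · have hκ := h κ
      rw [side, if_neg (not_or.mpr ⟨hκμ, hκν⟩)] at hκ
      exact (window_one_iff hn').mp hκ
    · have hκ := h μ
      rw [side, if_pos (Or.inl rfl)] at hκ
      push_cast at hκ
      exact (window_two_iff hn').mp hκ
    · have hκ := h ν
      rw [side, if_pos (Or.inr rfl)] at hκ
      push_cast at hκ
      exact (window_two_iff hn').mp hκ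
  · rintro ⟨hoff, hμ, hν⟩ κ
    rcases eq_or_ne κ μ with rfl | hκμ
    · rw [side, if_pos (Or.inl rfl)]
      push_cast
      exact (window_two_iff hn').mpr hμ
    rcases eq_or_ne κ ν with rfl | hκν
    · rw [side, if_pos (Or.inr rfl)]
      push_cast
      exact (window_two_iff hn').mpr hν
    · rw [side, if_neg (not_or.mpr ⟨hκμ, hκν⟩)]
      exact (window_one_iff hn').mpr (hoff κ hκμ hκν)

/-- **THE OVERLAP COUNT (one scale, one orientation):** a fine plaquette parallel to `p′` (lower-left corner `y`) lies in the region
`Δ′(p′)` of AT MOST FOUR level-`j` plaquettes `p′` — for any finite family `S` of positions, `#{z₀ ∈ S : y ∈ Δ′(p′_{z₀})} ≤ 4`: by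
`mem_deltaBox_smul_iff` the position is `z₀ = q(y) − a·e_μ − b·e_ν` with `(a, b) ∈ {0,1}²` — one candidate for each of the «four j-blocks Δ′
connected with the plaquette p′».  This is the unprinted point behind «We get these small factors for all plaquettes in all large fields
set P» (cell GAPS G-B10-10(a): «adjacent p′ share corner blocks, but the multiplicity is bounded»). [cite: Balaban1985UV3, (70)–(71) p.273] -/
theorem card_filter_mem_deltaBox_le (hn : 1 ≤ n) (hμν : μ ≠ ν) (S : Finset (Site d)) (y : Site d) :
    (S.filter fun z₀ => y ∈ deltaBox n (n • z₀) μ ν).card ≤ 4 := by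
  classical
  have h := Finset.card_le_card_of_injOn (fun z₀ : Site d => (y μ / n - z₀ μ, y ν / n - z₀ ν))
    (s := S.filter fun z₀ => y ∈ deltaBox n (n • z₀) μ ν) (t := ({0, 1} : Finset ℤ) ×ˢ ({0, 1} : Finset ℤ)) ?_ ?_
  · refine h.trans ?_
    rw [Finset.card_product]
    decide
  · intro z₀ hz
    obtain ⟨-, hμ, hν⟩ :=
      (mem_deltaBox_smul_iff n μ ν hn hμν y z₀).mp (Finset.mem_filter.mp (Finset.mem_coe.mp hz)).2
    simp only [Finset.coe_product, Set.mem_prod, Finset.mem_coe, Finset.mem_insert, Finset.mem_singleton]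
    constructor <;> omega
  · intro z hz z' hz' heq
    obtain ⟨hoff, -, -⟩ :=
      (mem_deltaBox_smul_iff n μ ν hn hμν y z).mp (Finset.mem_filter.mp (Finset.mem_coe.mp hz)).2
    obtain ⟨hoff', -, -⟩ :=
      (mem_deltaBox_smul_iff n μ ν hn hμν y z').mp (Finset.mem_filter.mp (Finset.mem_coe.mp hz')).2
    have h1 : y μ / n - z μ = y μ / n - z' μ := congrArg Prod.fst heq
    have h2 : y ν / n - z ν = y ν / n - z' ν := congrArg Prod.snd heq
    funext κ
    by_cases hκμ : κ = μ
    · subst hκμ; omega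
    by_cases hκν : κ = ν
    · subst hκν; omega
    rw [hoff κ hκμ hκν, hoff' κ hκμ hκν]

end Overlap

/-! ## §2 Bounded overlap ⇒ the localized sums add up to at most `m` times the total (the bookkeeping, any carrier) -/

section Bookkeeping

variable {α β : Type*} [DecidableEq β]

/-- **Bounded overlap, summed:** regions `R_i ⊆ Y` (`i ∈ T`) covering every point of `Y` at most `m` times and `G ≥ 0` on `Y` give
`Σ_{i∈T} Σ_{y∈R_i} G(y) ≤ m·Σ_{y∈Y} G(y)`.  With `R_i = Δ′(p′_i)`, `G(p) = η⁻¹[1 − Re tr U_k(∂p)] ≥ 0` this is how the localized parts of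
the ONE action `(1/g_k²)A^η(U_k)` used for different `p′` add up. [cite: Balaban1985UV3, (71) p.273] -/
theorem sum_sum_le_mul_of_overlap (T : Finset α) (R : α → Finset β) (Y : Finset β) (hR : ∀ i ∈ T, R i ⊆ Y)
    (G : β → ℝ) (hG : ∀ y ∈ Y, 0 ≤ G y) (m : ℕ) (hm : ∀ y ∈ Y, (T.filter fun i => y ∈ R i).card ≤ m) :
    ∑ i ∈ T, ∑ y ∈ R i, G y ≤ (m : ℝ) * ∑ y ∈ Y, G y := by
  have h1 : ∀ i ∈ T, ∑ y ∈ R i, G y = ∑ y ∈ Y, if y ∈ R i then G y else 0 := by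
    intro i hi
    rw [← Finset.sum_filter, Finset.filter_mem_eq_inter, Finset.inter_eq_right.mpr (hR i hi)]
  rw [Finset.sum_congr rfl h1, Finset.sum_comm, Finset.mul_sum]
  refine Finset.sum_le_sum fun y hy => ?_
  rw [← Finset.sum_filter, Finset.sum_const, nsmul_eq_mul]
  exact mul_le_mul_of_nonneg_right (by exact_mod_cast hm y hy) (hG y hy)

/-- **Per-region lower bounds transfer to the whole with the overlap constant:** if each region carries `w_i ≤ c·Σ_{y∈R_i} act(y)`
(`c ≥ 0`, `act ≥ 0` on `Y ⊇ R_i`, multiplicity `≤ m`), then `Σ_{i∈T} w_i ≤ m·c·Σ_{y∈Y} act(y)` — i.e. `c·Σ_Y act ≥ (1/m)·Σ_i w_i`, the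
shape «mainT ≥ c₁·Σ_{(j,p′)∈P} ¼p²(g_j)» of `B10LargeFieldSum.SmallFactorsAll` with `c₁ = 1/m`.  For several scales at once `m` is the
TOTAL multiplicity (HONEST SCOPE (ii): its value across scales is NOT derived in this file). [cite: Balaban1985UV3, (71) p.273] -/
theorem sum_le_mul_of_local_bounds (T : Finset α) (R : α → Finset β) (Y : Finset β) (hR : ∀ i ∈ T, R i ⊆ Y)
    (act : β → ℝ) (hact : ∀ y ∈ Y, 0 ≤ act y) (m : ℕ) (hm : ∀ y ∈ Y, (T.filter fun i => y ∈ R i).card ≤ m)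
    (w : α → ℝ) {c : ℝ} (hc : 0 ≤ c) (hw : ∀ i ∈ T, w i ≤ c * ∑ y ∈ R i, act y) :
    ∑ i ∈ T, w i ≤ (m : ℝ) * (c * ∑ y ∈ Y, act y) := by
  have h := sum_sum_le_mul_of_overlap T R Y hR act hact m hm
  calc ∑ i ∈ T, w i ≤ ∑ i ∈ T, c * ∑ y ∈ R i, act y := Finset.sum_le_sum hw
    _ = c * ∑ i ∈ T, ∑ y ∈ R i, act y := by rw [Finset.mul_sum]
    _ ≤ c * ((m : ℝ) * ∑ y ∈ Y, act y) := mul_le_mul_of_nonneg_left h hc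
    _ = (m : ℝ) * (c * ∑ y ∈ Y, act y) := by ring

end Bookkeeping

/-! ## §3 **(71) for all large-field plaquettes of one scale simultaneously** (`c₁ = ¼`) -/

section SameScale

variable {d : ℕ}

/-- **One scale, one orientation, from the per-plaquette (71):** let `S` be a finite family of positions `z₀` of level-`j` plaquettes
`p′` (orientation `μ ≠ ν`, `n = L^j ≥ 1`), `Y` a finite set of fine plaquettes (lower-left corners) containing every `Δ′(p′)`, `act ≥ 0` on
`Y`, `c ≥ 0` (print: `c = (1/g_k²)·η⁻¹`), and suppose (71) for each `p′ ∈ S`: `w(p′) ≤ c·Σ_{p⊂Δ′(p′)} act(p)` (print: `w = ¼p²(g_j)`).  Then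
**`¼·Σ_{p′∈S} w(p′) ≤ c·Σ_{p∈Y} act(p)`** — all the lower bounds hold against the one action with the share `c₁ = ¼`.
[cite: Balaban1985UV3, (71) p.273] -/
theorem quarter_sum_le_of_local71 (n : ℕ) (hn : 1 ≤ n) {μ ν : Fin d} (hμν : μ ≠ ν) (S Y : Finset (Site d))
    (hY : ∀ z₀ ∈ S, deltaBox n (n • z₀) μ ν ⊆ Y) (act : Site d → ℝ) (hact : ∀ y ∈ Y, 0 ≤ act y)
    (w : Site d → ℝ) {c : ℝ} (hc : 0 ≤ c) (h71 : ∀ z₀ ∈ S, w z₀ ≤ c * ∑ y ∈ deltaBox n (n • z₀) μ ν, act y) :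
    (1 / 4 : ℝ) * ∑ z₀ ∈ S, w z₀ ≤ c * ∑ y ∈ Y, act y := by
  classical
  have h := sum_le_mul_of_local_bounds S (fun z₀ => deltaBox n (n • z₀) μ ν) Y hY act hact 4
    (fun y _ => card_filter_mem_deltaBox_le n μ ν hn hμν S y) w hc h71
  have h4 : ((4 : ℕ) : ℝ) = 4 := by norm_num
  rw [h4] at h
  linarith

/-- The same in the form «the action dominates a quarter of every ¼p²»: with a CONSTANT weight `w(p′) = ¼p²` (one scale: all `g_j`
equal), `|S|·p²/16 ≤ c·Σ_{p∈Y} act(p)`. [cite: Balaban1985UV3, (71) p.273] -/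
theorem card_mul_le_of_local71 (n : ℕ) (hn : 1 ≤ n) {μ ν : Fin d} (hμν : μ ≠ ν) (S Y : Finset (Site d))
    (hY : ∀ z₀ ∈ S, deltaBox n (n • z₀) μ ν ⊆ Y) (act : Site d → ℝ) (hact : ∀ y ∈ Y, 0 ≤ act y)
    {p c : ℝ} (hc : 0 ≤ c) (h71 : ∀ z₀ ∈ S, p ^ 2 / 4 ≤ c * ∑ y ∈ deltaBox n (n • z₀) μ ν, act y) :
    (S.card : ℝ) * (p ^ 2 / 16) ≤ c * ∑ y ∈ Y, act y := by
  have h := quarter_sum_le_of_local71 n hn hμν S Y hY act hact (fun _ => p ^ 2 / 4) hc h71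
  rw [Finset.sum_const, nsmul_eq_mul] at h
  linarith

variable {𝔸 : Type*} [NormedRing 𝔸] [NormedAlgebra ℂ 𝔸] [CompleteSpace 𝔸]

/-- **Sect. D, (67)–(71) p. 273 FOR ALL LARGE-FIELD PLAQUETTES OF SCALE `j` (one orientation) SIMULTANEOUSLY, `d = 3`:** let `S` be a
finite family of level-`j` plaquettes `p′` (positions `z₀`, spanned by `e_μ, e_ν`, `μ ≠ ν`) each of which is a large-field plaquette of
`V_j` and satisfies the hypotheses of `B10Eq70Squaring.smallFactor_of_largeField` — **(67)** `Ū^j(∂p′) = V_j(∂p′)` with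
`|V_j(∂p′) − 1| ≥ g_jp(g_j)`, **(68)** `|U_k(∂p) − 1| ≤ C₁g_jp(g_j)L^{−2j}` on the sub-plaquettes, **(69)** with its remainder
`0 ≤ b(p′) ≤ C₂(g_jp(g_j))²`, (11) `|U(∂p) − 1|² ≤ 2·act(p)` on a finite fine region `Y ⊇ ⋃_{p′∈S}Δ′(p′)` with `act ≥ 0` there,
`g_k² = g_j²L^{k−j}`, `g_jp(g_j) ≤ 1`, «g_j sufficiently small» `½(2C₁C₂ + C₂²)g_jp(g_j) ≤ ¼`.  Then the part of `(1/g_k²)A^η(U_k)` over `Y`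
dominates A QUARTER of all the printed lower bounds at once: **`¼·Σ_{p′∈S} ¼p²(g_j) ≤ (1/g_k²)·L^k·Σ_{p∈Y} act(p)`** — what «We get these
small factors for all plaquettes in all large fields set P» yields at one scale, with the overlap made explicit (`c₁ = ¼`).
[cite: Balaban1985UV3, (67)–(71) p.273] -/
theorem smallFactors_sameScale (L : ℕ) (hL : 1 ≤ L) (j k : ℕ) (hjk : j ≤ k)
    (U Vj : Site 3 → Fin 3 → 𝔸ˣ) {μ ν : Fin 3} (hμν : μ ≠ ν) (act : Site 3 → ℝ) (S Y : Finset (Site 3))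
    (hY : ∀ z₀ ∈ S, deltaBox (L ^ j) ((L ^ j : ℕ) • z₀) μ ν ⊆ Y) (hact0 : ∀ y ∈ Y, 0 ≤ act y)
    (hact : ∀ y ∈ Y, dev U μ ν y ^ 2 ≤ 2 * act y)
    {gj gk p C₁ C₂ : ℝ} (b : Site 3 → ℝ) (hgj : 0 < gj) (hgk : gk ^ 2 = gj ^ 2 * (L : ℝ) ^ (k - j)) (hp : 0 ≤ p)
    (hgp : gj * p ≤ 1)
    (h67 : ∀ z₀ ∈ S, hol (avgIter L U j) z₀ (plaqWord μ ν) = hol Vj z₀ (plaqWord μ ν))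
    (hLF : ∀ z₀ ∈ S, gj * p ≤ ‖((hol Vj z₀ (plaqWord μ ν) : 𝔸ˣ) : 𝔸) - 1‖)
    (h68 : ∀ z₀ ∈ S, ∀ t : Idx 3 (L ^ j),
      dev U μ ν (corner (L ^ j) ((L ^ j : ℕ) • z₀) μ ν t) ≤ C₁ * (gj * p) / ((L : ℝ) ^ j) ^ 2)
    (h69 : ∀ z₀ ∈ S, ‖((hol (avgIter L U j) z₀ (plaqWord μ ν) : 𝔸ˣ) : 𝔸) - 1‖ <
      blockSum (L ^ j) ((L ^ j : ℕ) • z₀) μ ν (dev U μ ν) + b z₀)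
    (hb : ∀ z₀ ∈ S, 0 ≤ b z₀ ∧ b z₀ ≤ C₂ * (gj * p) ^ 2)
    (hsmall : (2 * C₁ * C₂ + C₂ ^ 2) / 2 * gj * p ≤ 1 / 4) :
    (1 / 4 : ℝ) * ∑ _z₀ ∈ S, p ^ 2 / 4 ≤ (gk ^ 2)⁻¹ * ((L : ℝ) ^ k * ∑ y ∈ Y, act y) := by
  have hn : 1 ≤ L ^ j := Nat.one_le_pow _ _ hL
  have hc : (0 : ℝ) ≤ (gk ^ 2)⁻¹ * (L : ℝ) ^ k := by positivity
  have h71 : ∀ z₀ ∈ S, p ^ 2 / 4 ≤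
      (gk ^ 2)⁻¹ * (L : ℝ) ^ k * ∑ y ∈ deltaBox (L ^ j) ((L ^ j : ℕ) • z₀) μ ν, act y := by
    intro z₀ hz
    have h := smallFactor_of_largeField L hL j k hjk U Vj z₀ hμν act (fun y hy => hact y (hY z₀ hz hy)) hgj hgk hp
      hgp (h67 z₀ hz) (hLF z₀ hz) (h68 z₀ hz) (h69 z₀ hz) (hb z₀ hz).1 (hb z₀ hz).2 hsmall
    rw [mul_assoc]; exact h
  have h := quarter_sum_le_of_local71 (L ^ j) hn hμν S Y hY act hact0 (fun _ => p ^ 2 / 4) hc h71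
  rw [mul_assoc] at h
  exact h

/-- Cardinality form of `smallFactors_sameScale`: **`|S|·p²(g_j)/16 ≤ (1/g_k²)·L^k·Σ_{p∈Y} act(p)`** (`|S|` = the number of large-field
plaquettes of scale `j` and this orientation whose regions lie in `Y`). [cite: Balaban1985UV3, (67)–(71) p.273] -/
theorem card_smallFactors_sameScale (L : ℕ) (hL : 1 ≤ L) (j k : ℕ) (hjk : j ≤ k)
    (U Vj : Site 3 → Fin 3 → 𝔸ˣ) {μ ν : Fin 3} (hμν : μ ≠ ν) (act : Site 3 → ℝ) (S Y : Finset (Site 3))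
    (hY : ∀ z₀ ∈ S, deltaBox (L ^ j) ((L ^ j : ℕ) • z₀) μ ν ⊆ Y) (hact0 : ∀ y ∈ Y, 0 ≤ act y)
    (hact : ∀ y ∈ Y, dev U μ ν y ^ 2 ≤ 2 * act y)
    {gj gk p C₁ C₂ : ℝ} (b : Site 3 → ℝ) (hgj : 0 < gj) (hgk : gk ^ 2 = gj ^ 2 * (L : ℝ) ^ (k - j)) (hp : 0 ≤ p)
    (hgp : gj * p ≤ 1)
    (h67 : ∀ z₀ ∈ S, hol (avgIter L U j) z₀ (plaqWord μ ν) = hol Vj z₀ (plaqWord μ ν))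
    (hLF : ∀ z₀ ∈ S, gj * p ≤ ‖((hol Vj z₀ (plaqWord μ ν) : 𝔸ˣ) : 𝔸) - 1‖)
    (h68 : ∀ z₀ ∈ S, ∀ t : Idx 3 (L ^ j),
      dev U μ ν (corner (L ^ j) ((L ^ j : ℕ) • z₀) μ ν t) ≤ C₁ * (gj * p) / ((L : ℝ) ^ j) ^ 2)
    (h69 : ∀ z₀ ∈ S, ‖((hol (avgIter L U j) z₀ (plaqWord μ ν) : 𝔸ˣ) : 𝔸) - 1‖ <
      blockSum (L ^ j) ((L ^ j : ℕ) • z₀) μ ν (dev U μ ν) + b z₀)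
    (hb : ∀ z₀ ∈ S, 0 ≤ b z₀ ∧ b z₀ ≤ C₂ * (gj * p) ^ 2)
    (hsmall : (2 * C₁ * C₂ + C₂ ^ 2) / 2 * gj * p ≤ 1 / 4) :
    (S.card : ℝ) * (p ^ 2 / 16) ≤ (gk ^ 2)⁻¹ * ((L : ℝ) ^ k * ∑ y ∈ Y, act y) := by
  have h := smallFactors_sameScale L hL j k hjk U Vj hμν act S Y hY hact0 hact b hgj hgk hp hgp h67 hLF h68 h69 hb
    hsmall
  rw [Finset.sum_const, nsmul_eq_mul] at h
  linarith

/-- **The surviving small factors** (p. 273 «the corresponding part of the exponential gives the small factor exp(−1/4p²(g_j)). We get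
these small factors for all plaquettes in all large fields set P»): at one scale and orientation the exponential of minus the action over
`Y` is at most `exp(−|S|·p²(g_j)/16) = (Π_{p′∈S} exp(−¼p²(g_j)))^{1/4}` — a quarter (in the exponent) of every printed small factor
survives simultaneously. [cite: Balaban1985UV3, (71) p.273] -/
theorem exp_action_le_prod_smallFactors_quarter (L : ℕ) (hL : 1 ≤ L) (j k : ℕ) (hjk : j ≤ k)
    (U Vj : Site 3 → Fin 3 → 𝔸ˣ) {μ ν : Fin 3} (hμν : μ ≠ ν) (act : Site 3 → ℝ) (S Y : Finset (Site 3))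
    (hY : ∀ z₀ ∈ S, deltaBox (L ^ j) ((L ^ j : ℕ) • z₀) μ ν ⊆ Y) (hact0 : ∀ y ∈ Y, 0 ≤ act y)
    (hact : ∀ y ∈ Y, dev U μ ν y ^ 2 ≤ 2 * act y)
    {gj gk p C₁ C₂ : ℝ} (b : Site 3 → ℝ) (hgj : 0 < gj) (hgk : gk ^ 2 = gj ^ 2 * (L : ℝ) ^ (k - j)) (hp : 0 ≤ p)
    (hgp : gj * p ≤ 1)
    (h67 : ∀ z₀ ∈ S, hol (avgIter L U j) z₀ (plaqWord μ ν) = hol Vj z₀ (plaqWord μ ν))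
    (hLF : ∀ z₀ ∈ S, gj * p ≤ ‖((hol Vj z₀ (plaqWord μ ν) : 𝔸ˣ) : 𝔸) - 1‖)
    (h68 : ∀ z₀ ∈ S, ∀ t : Idx 3 (L ^ j),
      dev U μ ν (corner (L ^ j) ((L ^ j : ℕ) • z₀) μ ν t) ≤ C₁ * (gj * p) / ((L : ℝ) ^ j) ^ 2)
    (h69 : ∀ z₀ ∈ S, ‖((hol (avgIter L U j) z₀ (plaqWord μ ν) : 𝔸ˣ) : 𝔸) - 1‖ <
      blockSum (L ^ j) ((L ^ j : ℕ) • z₀) μ ν (dev U μ ν) + b z₀)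
    (hb : ∀ z₀ ∈ S, 0 ≤ b z₀ ∧ b z₀ ≤ C₂ * (gj * p) ^ 2)
    (hsmall : (2 * C₁ * C₂ + C₂ ^ 2) / 2 * gj * p ≤ 1 / 4) :
    Real.exp (-((gk ^ 2)⁻¹ * ((L : ℝ) ^ k * ∑ y ∈ Y, act y))) ≤
      (∏ _z₀ ∈ S, Real.exp (-(p ^ 2 / 4))) ^ (1 / 4 : ℝ) := by
  have h := card_smallFactors_sameScale L hL j k hjk U Vj hμν act S Y hY hact0 hact b hgj hgk hp hgp h67 hLF h68 h69
    hb hsmall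
  have hprod : (∏ _z₀ ∈ S, Real.exp (-(p ^ 2 / 4))) ^ (1 / 4 : ℝ) = Real.exp (-((S.card : ℝ) * (p ^ 2 / 16))) := by
    rw [Finset.prod_const, ← Real.exp_nat_mul, ← Real.exp_mul]
    congr 1
    ring
  rw [hprod]
  exact Real.exp_le_exp.mpr (by linarith)

end SameScale

/-! ## §3b The paper's groups `U(N)` / `SU(N)` (operator norm of [4] (19)): all plaquettes of a scale, end to end -/

section Matrices

open scoped Matrix.Norms.L2Operator
open B10Eq71Concrete (smallFactor_unitaryGroup smallFactor_specialUnitary dev_sq_le_two_act_specialUnitary)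
open B7Prop2SpecialUnitary (specialUnitaryUnits)

/-- **(68) ⇒ (69) ⇒ (70) ⇒ (71) FOR ALL LARGE-FIELD PLAQUETTES OF SCALE `j` AT ONCE, `G = U(N)`, `N ≥ 1`, operator norm, `d = 3`:**
`U` a `U(N)`-valued fine configuration with (68) `sup_p |U(∂p) − 1| < α₀L^{−2j}`, `α₀ ≤ C₁g_jp(g_j)` and the Prop.-2 smallness of [4]
(`C₀α₀ ≤ ⅓`, `2α₀ ≤ c₂′`), `Ū^j = avgIter L U j` the concrete `j`-fold average ((67): `V_j = Ū^j`), `S` ANY finite family of level-`j`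
plaquettes (positions `z₀`, orientation `μ ≠ ν`) with `|Ū^j(∂p′) − 1| ≥ g_jp(g_j)` (large field), `Y ⊇ ⋃_{p′∈S}Δ′(p′)` finite, `g_k² = g_j²L^{k−j}`,
`g_jp(g_j) ≤ 1`, «g_j sufficiently small» as in `B10Eq71Concrete.smallFactor_unitaryGroup`.  THEN
**`|S|·p²(g_j)/16 ≤ (1/g_k²)·L^k·Σ_{p∈Y} N(1 − Re tr U(∂p))`** (`tr = N⁻¹Tr`; the dimension factor of cell DIVERGENCE D-b10.1) — every
large-field plaquette of the scale costs at least `p²(g_j)/16` of the one Wilson action. [cite: Balaban1985UV3, (67)–(71) p.273] -/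
theorem card_smallFactors_unitaryGroup (N : ℕ) [NeZero N] (L : ℕ) (hL : 2 ≤ L) (j k : ℕ) (hjk : j ≤ k)
    (U : Site 3 → Fin 3 → (Matrix (Fin N) (Fin N) ℂ)ˣ) (hU : ∀ x κ, U x κ ∈ unitaryUnits (Matrix (Fin N) (Fin N) ℂ))
    {μ ν : Fin 3} (hμν : μ ≠ ν) (S Y : Finset (Site 3)) (hY : ∀ z₀ ∈ S, deltaBox (L ^ j) ((L ^ j : ℕ) • z₀) μ ν ⊆ Y)
    {gj gk p α₀ C₁ : ℝ} (hgj : 0 < gj) (hgk : gk ^ 2 = gj ^ 2 * (L : ℝ) ^ (k - j)) (hp : 0 ≤ p) (hgp : gj * p ≤ 1)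
    (hα : 0 < α₀) (hα3 : C0 3 * α₀ ≤ 1 / 3) (hα2 : 2 * α₀ ≤ c2' 3 L)
    (h68 : pdev U < α₀ * (((L : ℝ) ^ j)⁻¹) ^ 2) (hαε : α₀ ≤ C₁ * (gj * p))
    (hLF : ∀ z₀ ∈ S, gj * p ≤
      ‖((hol (avgIter L U j) z₀ (plaqWord μ ν) : (Matrix (Fin N) (Fin N) ℂ)ˣ) : Matrix (Fin N) (Fin N) ℂ) - 1‖)
    (hsmall : (2 * C₁ * (16 / 3 * C0 3 * C₁ ^ 2) + (16 / 3 * C0 3 * C₁ ^ 2) ^ 2) / 2 * gj * p ≤ 1 / 4) :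
    (S.card : ℝ) * (p ^ 2 / 16) ≤ (gk ^ 2)⁻¹ * ((L : ℝ) ^ k *
      ∑ y ∈ Y, (N : ℝ) * (1 - (N : ℝ)⁻¹ *
        (((hol U y (plaqWord μ ν) : (Matrix (Fin N) (Fin N) ℂ)ˣ) : Matrix (Fin N) (Fin N) ℂ).trace.re))) := by
  set act : Site 3 → ℝ := fun y => (N : ℝ) * (1 - (N : ℝ)⁻¹ *
    (((hol U y (plaqWord μ ν) : (Matrix (Fin N) (Fin N) ℂ)ˣ) : Matrix (Fin N) (Fin N) ℂ).trace.re)) with hact_def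
  have hact0 : ∀ y ∈ Y, 0 ≤ act y := by
    intro y _
    have h := dev_sq_le_two_act_unitary U hU μ ν y
    have h2 := sq_nonneg (dev U μ ν y)
    show 0 ≤ (N : ℝ) * _
    linarith
  have hc : (0 : ℝ) ≤ (gk ^ 2)⁻¹ * (L : ℝ) ^ k := by positivity
  have h71 : ∀ z₀ ∈ S, p ^ 2 / 4 ≤
      (gk ^ 2)⁻¹ * (L : ℝ) ^ k * ∑ y ∈ deltaBox (L ^ j) ((L ^ j : ℕ) • z₀) μ ν, act y := by
    intro z₀ hz
    have h := smallFactor_unitaryGroup N L hL j k hjk U hU z₀ hμν hgj hgk hp hgp hα hα3 hα2 h68 hαε (hLF z₀ hz) hsmall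
    rw [mul_assoc]; exact h
  have hn : 1 ≤ L ^ j := Nat.one_le_pow _ _ (le_trans (by norm_num) hL)
  have h := card_mul_le_of_local71 (L ^ j) hn hμν S Y hY act hact0 hc h71
  rw [mul_assoc] at h
  exact h

variable {n : Type*} [Fintype n] [DecidableEq n] [Nonempty n]

/-- **The same for `G = SU(N)`, the semi-simple case of Theorem 1** (p. 257 «with a semi-simple compact group Lie G»): with the one extra
`G`-dependent smallness `N·32(d+1)(d+4)L²α₀ < π` of `B7Prop2SpecialUnitary.avgClosedAt_specialUnitary` (the average (42) stays in `SU(N)`),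
**`|S|·p²(g_j)/16 ≤ (1/g_k²)·L^k·Σ_{p∈Y} N(1 − Re tr U(∂p))`** for every finite family `S` of large-field plaquettes of scale `j` of the
concrete average and every finite `Y ⊇ ⋃Δ′(p′)`. [cite: Balaban1985UV3, (67)–(71) p.273, Thm 1 p.257] -/
theorem card_smallFactors_specialUnitary (L : ℕ) (hL : 2 ≤ L) (j k : ℕ) (hjk : j ≤ k)
    (U : Site 3 → Fin 3 → (Matrix n n ℂ)ˣ) (hU : ∀ x κ, U x κ ∈ specialUnitaryUnits n)
    {μ ν : Fin 3} (hμν : μ ≠ ν) (S Y : Finset (Site 3)) (hY : ∀ z₀ ∈ S, deltaBox (L ^ j) ((L ^ j : ℕ) • z₀) μ ν ⊆ Y)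
    {gj gk p α₀ C₁ : ℝ} (hgj : 0 < gj) (hgk : gk ^ 2 = gj ^ 2 * (L : ℝ) ^ (k - j)) (hp : 0 ≤ p) (hgp : gj * p ≤ 1)
    (hα : 0 < α₀) (hα3 : C0 3 * α₀ ≤ 1 / 3) (hα2 : 2 * α₀ ≤ c2' 3 L)
    (hαN : Fintype.card n * (32 * ((3 : ℝ) + 1) * (3 + 4) * (L : ℝ) ^ 2 * α₀) < Real.pi)
    (h68 : pdev U < α₀ * (((L : ℝ) ^ j)⁻¹) ^ 2) (hαε : α₀ ≤ C₁ * (gj * p))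
    (hLF : ∀ z₀ ∈ S, gj * p ≤ ‖((hol (avgIter L U j) z₀ (plaqWord μ ν) : (Matrix n n ℂ)ˣ) : Matrix n n ℂ) - 1‖)
    (hsmall : (2 * C₁ * (16 / 3 * C0 3 * C₁ ^ 2) + (16 / 3 * C0 3 * C₁ ^ 2) ^ 2) / 2 * gj * p ≤ 1 / 4) :
    (S.card : ℝ) * (p ^ 2 / 16) ≤ (gk ^ 2)⁻¹ * ((L : ℝ) ^ k *
      ∑ y ∈ Y, (Fintype.card n : ℝ) * (1 - (Fintype.card n : ℝ)⁻¹ *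
        (((hol U y (plaqWord μ ν) : (Matrix n n ℂ)ˣ) : Matrix n n ℂ).trace.re))) := by
  set act : Site 3 → ℝ := fun y => (Fintype.card n : ℝ) * (1 - (Fintype.card n : ℝ)⁻¹ *
    (((hol U y (plaqWord μ ν) : (Matrix n n ℂ)ˣ) : Matrix n n ℂ).trace.re)) with hact_def
  have hact0 : ∀ y ∈ Y, 0 ≤ act y := by
    intro y _
    have h := dev_sq_le_two_act_specialUnitary U hU μ ν y
    have h2 := sq_nonneg (dev U μ ν y)
    show 0 ≤ (Fintype.card n : ℝ) * _
    linarith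
  have hc : (0 : ℝ) ≤ (gk ^ 2)⁻¹ * (L : ℝ) ^ k := by positivity
  have h71 : ∀ z₀ ∈ S, p ^ 2 / 4 ≤
      (gk ^ 2)⁻¹ * (L : ℝ) ^ k * ∑ y ∈ deltaBox (L ^ j) ((L ^ j : ℕ) • z₀) μ ν, act y := by
    intro z₀ hz
    have h := smallFactor_specialUnitary L hL j k hjk U hU z₀ hμν hgj hgk hp hgp hα hα3 hα2 hαN h68 hαε (hLF z₀ hz)
      hsmall
    rw [mul_assoc]; exact h
  have hn : 1 ≤ L ^ j := Nat.one_le_pow _ _ (le_trans (by norm_num) hL)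
  have h := card_mul_le_of_local71 (L ^ j) hn hμν S Y hY act hact0 hc h71
  rw [mul_assoc] at h
  exact h

end Matrices

/-! ## §4 All orientations at once; several scales with the cross-scale multiplicity as a hypothesis -/

section Orientations

variable {d : ℕ}

/-- **All orientations at one scale:** the fine plaquettes of different orientations `o = (μ, ν)` are DIFFERENT terms of `A^η(U_k)`, so the
families `S_o` of large-field plaquettes of scale `j`, orientation by orientation, still take only the share `c₁ = ¼`:
`¼·Σ_{o∈O} Σ_{p′∈S_o} w_o(p′) ≤ c·Σ_{o∈O} Σ_{p∈Y_o} act_o(p)` (the right-hand side is the part of `c·A^η` over the plaquettes of the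
orientations in `O` with corners in the `Y_o`). [cite: Balaban1985UV3, (71) p.273] -/
theorem quarter_sum_le_of_local71_orient (n : ℕ) (hn : 1 ≤ n) (O : Finset (Fin d × Fin d)) (hO : ∀ o ∈ O, o.1 ≠ o.2)
    (S Y : Fin d × Fin d → Finset (Site d)) (hY : ∀ o ∈ O, ∀ z₀ ∈ S o, deltaBox n (n • z₀) o.1 o.2 ⊆ Y o)
    (act : Fin d × Fin d → Site d → ℝ) (hact : ∀ o ∈ O, ∀ y ∈ Y o, 0 ≤ act o y)
    (w : Fin d × Fin d → Site d → ℝ) {c : ℝ} (hc : 0 ≤ c)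
    (h71 : ∀ o ∈ O, ∀ z₀ ∈ S o, w o z₀ ≤ c * ∑ y ∈ deltaBox n (n • z₀) o.1 o.2, act o y) :
    (1 / 4 : ℝ) * ∑ o ∈ O, ∑ z₀ ∈ S o, w o z₀ ≤ c * ∑ o ∈ O, ∑ y ∈ Y o, act o y := by
  rw [Finset.mul_sum, Finset.mul_sum]
  exact Finset.sum_le_sum fun o ho =>
    quarter_sum_le_of_local71 n hn (hO o ho) (S o) (Y o) (hY o ho) (act o) (hact o ho) (w o) hc (h71 o ho)

/-- **Several scales (the cross-scale overlap as an explicit hypothesis):** index the large-field plaquettes of all scales by `i ∈ T`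
(print: the pairs `(j, p′)`, `p′ ∈ P_j`), with regions `R_i = Δ′_j(p′)` inside a finite fine region `Y`, weights `w_i = ¼p²(g_j)` and the
per-plaquette (71) `w_i ≤ c·Σ_{p∈R_i} act(p)`; IF every fine plaquette of `Y` lies in at most `m` of the regions (all scales together),
THEN `(1/m)·Σ_{i∈T} w_i ≤ c·Σ_{p∈Y} act(p)` — `SmallFactorsAll`'s shape with `c₁ = 1/m`.  At one scale `m = 4` (§1/§3); the bound on `m`
across scales (cell GAPS G-B10-10(a): only adjacent scales meet, by (39)) is NOT derived here. [cite: Balaban1985UV3, (71) p.273] -/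
theorem inv_mul_sum_le_of_local71_multiscale {ι : Type*} (T : Finset ι) (R : ι → Finset (Site d)) (Y : Finset (Site d))
    (hR : ∀ i ∈ T, R i ⊆ Y) (act : Site d → ℝ) (hact : ∀ y ∈ Y, 0 ≤ act y) (m : ℕ) (hm0 : 1 ≤ m)
    (hm : ∀ y ∈ Y, (T.filter fun i => y ∈ R i).card ≤ m) (w : ι → ℝ) {c : ℝ} (hc : 0 ≤ c)
    (h71 : ∀ i ∈ T, w i ≤ c * ∑ y ∈ R i, act y) :
    (m : ℝ)⁻¹ * ∑ i ∈ T, w i ≤ c * ∑ y ∈ Y, act y := by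
  classical
  have h := sum_le_mul_of_local_bounds T R Y hR act hact m hm w hc h71
  have hm' : (0 : ℝ) < m := by exact_mod_cast hm0
  rw [inv_mul_le_iff₀ hm']
  exact h

end Orientations

/-! ## §4b Across scales: the regions of DIFFERENT scales are disjoint under (38) and the p. 268 rule, so `c₁ = ¼` survives -/

section Scales

variable {d : ℕ}

/-- **ACROSS SCALES the regions do not meet at all** — given the domain geometry of (38)/(48) and the p. 268 rule read on the fine lattice.
Index the large-field plaquettes of all scales by pairs `i = (j, z₀) ∈ T` (scale, position; one orientation `μ ≠ ν`; `n_j = L^j`), and let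
`D_j` be the set of fine sites of `Ω_{j+1}` (print: `Ω_{j+1}^{(j)} = B(Λ_{j+1})`, (48) p. 268).  HYPOTHESES (the reading, each a located
sentence): `hout` — the four corner blocks of `p′ ∈ P_j` lie OUTSIDE `Ω_{j+1}` (p. 273 «a plaquette p′ ⊂ Λ_j», p. 268 (the sentences introducing (48)) «Λ_k = Ω_k^{(k)} ∖ Ω_{k+1}^{(k)}»,
and p. 268 «We define the set Ω_{k+1}^{(k)} as a union of big blocks of the lattice T₁^{(k)}, with distances to P ∪ Ω_k^{(k)c} greater than
R(g_k)M₁»), i.e. `Δ′_j(p′) ∩ D_j = ∅`; `hin` — for a later scale `j′ > j`, `Δ′_{j′}(p″) ⊆ D_j` (p″ ⊂ Λ_{j′} ⊂ Ω_{j′}` and (38) «Ω_k ⊂ Ω_{k−1} ⊂ …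
⊂ Ω₁» p. 266, so `Ω_{j′} ⊆ Ω_{j+1}`).  THEN every fine plaquette lies in the regions of AT MOST ONE scale, hence (§1) in at most FOUR regions
altogether: `#{(j, p′) ∈ T : y ∈ Δ′_j(p′)} ≤ 4`.  (The cell's note G-B10-10(a) estimated «≤ 3 adjacent scales overlap … c₁ ≥ 1/36» from (39); under
the two inclusions above no two scales overlap.  On the torus carrier the nesting (38) and the rule are `B10Eq38TorusDomains.nested38_ruleSeq` /
`ruleDom`; the transport of `D_j` from there is NOT done here — HONEST SCOPE (ii).) [cite: Balaban1985UV3, (71) p.273, (38) p.266, (48) p.268] -/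
theorem card_filter_scales_le (T : Finset (ℕ × Site d)) (n : ℕ → ℕ) (hn : ∀ i ∈ T, 1 ≤ n i.1) {μ ν : Fin d} (hμν : μ ≠ ν)
    (D : ℕ → Set (Site d))
    (hout : ∀ i ∈ T, ∀ y ∈ deltaBox (n i.1) (n i.1 • i.2) μ ν, y ∉ D i.1)
    (hin : ∀ i ∈ T, ∀ i' ∈ T, i.1 < i'.1 → ∀ y ∈ deltaBox (n i'.1) (n i'.1 • i'.2) μ ν, y ∈ D i.1)
    (y : Site d) :
    (T.filter fun i => y ∈ deltaBox (n i.1) (n i.1 • i.2) μ ν).card ≤ 4 := by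
  classical
  set F := T.filter fun i => y ∈ deltaBox (n i.1) (n i.1 • i.2) μ ν with hF
  rcases F.eq_empty_or_nonempty with h0 | ⟨i₀, hi₀⟩
  · rw [h0]; simp
  have hi₀T : i₀ ∈ T := (Finset.mem_filter.mp hi₀).1
  have hyi₀ : y ∈ deltaBox (n i₀.1) (n i₀.1 • i₀.2) μ ν := (Finset.mem_filter.mp hi₀).2
  -- every region containing `y` has the scale of `i₀`
  have hlev : ∀ i ∈ F, i.1 = i₀.1 := by
    intro i hi
    have hiT : i ∈ T := (Finset.mem_filter.mp hi).1
    have hyi : y ∈ deltaBox (n i.1) (n i.1 • i.2) μ ν := (Finset.mem_filter.mp hi).2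
    by_contra hne
    rcases lt_or_gt_of_ne hne with hlt | hgt
    · exact hout i hiT y hyi (hin i hiT i₀ hi₀T hlt y hyi₀)
    · exact hout i₀ hi₀T y hyi₀ (hin i₀ hi₀T i hiT hgt y hyi)
  -- positions of that scale
  set S₀ : Finset (Site d) := (T.filter fun i => i.1 = i₀.1).image Prod.snd with hS₀
  have h := Finset.card_le_card_of_injOn Prod.snd (s := F)
    (t := S₀.filter fun z => y ∈ deltaBox (n i₀.1) (n i₀.1 • z) μ ν) ?_ ?_
  · exact h.trans (card_filter_mem_deltaBox_le (n i₀.1) μ ν (hn i₀ hi₀T) hμν S₀ y)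
  · intro i hi
    have hi' : i ∈ F := Finset.mem_coe.mp hi
    have hiT : i ∈ T := (Finset.mem_filter.mp hi').1
    have hyi : y ∈ deltaBox (n i.1) (n i.1 • i.2) μ ν := (Finset.mem_filter.mp hi').2
    have hl := hlev i hi'
    refine Finset.mem_coe.mpr (Finset.mem_filter.mpr ⟨?_, ?_⟩)
    · exact Finset.mem_image.mpr ⟨i, Finset.mem_filter.mpr ⟨hiT, hl⟩, rfl⟩
    · rw [← hl]; exact hyi
  · intro i hi i' hi' heq
    have hl := hlev i (Finset.mem_coe.mp hi)
    have hl' := hlev i' (Finset.mem_coe.mp hi')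
    exact Prod.ext (hl.trans hl'.symm) heq

/-- **(71) FOR ALL LARGE-FIELD PLAQUETTES OF ALL SCALES SIMULTANEOUSLY, `c₁ = ¼`** (one orientation; under the two geometric inclusions of
`card_filter_scales_le` = (38) + the p. 268 rule read on the fine lattice): with the per-plaquette (71) `w(j, p′) ≤ c·Σ_{p⊂Δ′_j(p′)} act(p)`
(print: `w = ¼p²(g_j)`, `c = (1/g_k²)η⁻¹`), `act ≥ 0` on a finite fine region `Y` containing all the regions:
**`¼·Σ_{(j,p′)∈T} w(j, p′) ≤ c·Σ_{p∈Y} act(p)`** — the shape «c₁·Σ_{(j,p′)∈P} ¼p²(g_j) ≤ mainT» of `B10LargeFieldSum.SmallFactorsAll` with the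
ABSOLUTE `c₁ = ¼`. [cite: Balaban1985UV3, (71) p.273, (38) p.266, (48) p.268] -/
theorem quarter_sum_le_of_local71_scales (T : Finset (ℕ × Site d)) (n : ℕ → ℕ) (hn : ∀ i ∈ T, 1 ≤ n i.1) {μ ν : Fin d}
    (hμν : μ ≠ ν) (D : ℕ → Set (Site d))
    (hout : ∀ i ∈ T, ∀ y ∈ deltaBox (n i.1) (n i.1 • i.2) μ ν, y ∉ D i.1)
    (hin : ∀ i ∈ T, ∀ i' ∈ T, i.1 < i'.1 → ∀ y ∈ deltaBox (n i'.1) (n i'.1 • i'.2) μ ν, y ∈ D i.1)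
    (Y : Finset (Site d)) (hY : ∀ i ∈ T, deltaBox (n i.1) (n i.1 • i.2) μ ν ⊆ Y) (act : Site d → ℝ)
    (hact : ∀ y ∈ Y, 0 ≤ act y) (w : ℕ × Site d → ℝ) {c : ℝ} (hc : 0 ≤ c)
    (h71 : ∀ i ∈ T, w i ≤ c * ∑ y ∈ deltaBox (n i.1) (n i.1 • i.2) μ ν, act y) :
    (1 / 4 : ℝ) * ∑ i ∈ T, w i ≤ c * ∑ y ∈ Y, act y := by
  classical
  have h := sum_le_mul_of_local_bounds T (fun i => deltaBox (n i.1) (n i.1 • i.2) μ ν) Y hY act hact 4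
    (fun y _ => card_filter_scales_le T n hn hμν D hout hin y) w hc h71
  have h4 : ((4 : ℕ) : ℝ) = 4 := by norm_num
  rw [h4] at h
  linarith

/-- The printed weights: with `w(j, p′) = ¼p(g_j)²` for a coupling progression `g : ℕ → ℝ` and `p = B10.pFun b₀ p₀`, the conclusion reads
`¼·Σ_{(j,p′)∈T} ¼p(g_j)² ≤ c·Σ_{p∈Y} act(p)` — literally `B10LargeFieldSum.SmallFactorsAll`'s inequality `c₁·Σ_{e∈disc} p(g_{e.1})²/4 ≤ mainT`
at `c₁ = ¼`, for the part of the main action over `Y`. [cite: Balaban1985UV3, (71) p.273, (41) p.266] -/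
theorem smallFactorsAll_shape_scales (T : Finset (ℕ × Site d)) (n : ℕ → ℕ) (hn : ∀ i ∈ T, 1 ≤ n i.1) {μ ν : Fin d}
    (hμν : μ ≠ ν) (D : ℕ → Set (Site d))
    (hout : ∀ i ∈ T, ∀ y ∈ deltaBox (n i.1) (n i.1 • i.2) μ ν, y ∉ D i.1)
    (hin : ∀ i ∈ T, ∀ i' ∈ T, i.1 < i'.1 → ∀ y ∈ deltaBox (n i'.1) (n i'.1 • i'.2) μ ν, y ∈ D i.1)
    (Y : Finset (Site d)) (hY : ∀ i ∈ T, deltaBox (n i.1) (n i.1 • i.2) μ ν ⊆ Y) (act : Site d → ℝ)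
    (hact : ∀ y ∈ Y, 0 ≤ act y) (b₀ p₀ : ℝ) (g : ℕ → ℝ) {c : ℝ} (hc : 0 ≤ c)
    (h71 : ∀ i ∈ T, B10.pFun b₀ p₀ (g i.1) ^ 2 / 4 ≤ c * ∑ y ∈ deltaBox (n i.1) (n i.1 • i.2) μ ν, act y) :
    (1 / 4 : ℝ) * ∑ i ∈ T, B10.pFun b₀ p₀ (g i.1) ^ 2 / 4 ≤ c * ∑ y ∈ Y, act y :=
  quarter_sum_le_of_local71_scales T n hn hμν D hout hin Y hY act hact (fun i => B10.pFun b₀ p₀ (g i.1) ^ 2 / 4) hc h71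

end Scales

/-! ## §5 Non-vacuity of the overlap count: the bound `4` is attained -/

section Sharp

/-- The count `4` of §1 is SHARP already in `d = 2`, `n = 1`: the fine plaquette at `y = (1, 1)` lies in `Δ′(p′)` for the four unit
plaquettes at `(0,0), (1,0), (0,1), (1,1)` (it is a corner-block plaquette of each).  (bookkeeping check of the overlap geometry of (70), no
content of the series) [cite: Balaban1985UV3, (70) p.273] -/
theorem overlap_four_attained :
    ((({![0, 0], ![1, 0], ![0, 1], ![1, 1]} : Finset (Site 2)).filter fun z₀ =>
        (![1, 1] : Site 2) ∈ deltaBox 1 (1 • z₀) (0 : Fin 2) 1)).card = 4 := by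
  have hmem : ∀ z₀ ∈ ({![0, 0], ![1, 0], ![0, 1], ![1, 1]} : Finset (Site 2)),
      (![1, 1] : Site 2) ∈ deltaBox 1 (1 • z₀) (0 : Fin 2) 1 := by
    intro z₀ hz
    rw [mem_deltaBox_smul_iff 1 (0 : Fin 2) 1 le_rfl (by decide)]
    simp only [Finset.mem_insert, Finset.mem_singleton] at hz
    refine ⟨fun κ h0 h1 => ?_, ?_, ?_⟩
    · exfalso; fin_cases κ <;> simp_all
    · rcases hz with rfl | rfl | rfl | rfl <;> simp
    · rcases hz with rfl | rfl | rfl | rfl <;> simp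
  rw [Finset.filter_true_of_mem hmem]
  decide

end Sharp

/-! ## §4c (v1.1) The cross-scale inclusions from the cell's typed rule of p. 268 (`B10LargeField.Rule268`) -/

section Rule268

variable {d : ℕ}

/-- **`hout` from the rule.**  Let the domains of Sect. B live on the fine lattice: `D : B10LargeField.DomainSeq` with `Pt = Site d`
(`D.Ω j` = the fine sites of `Ω_j`, `D.P j` = the fine sites covered by the large-field plaquettes `P_j`, `D.bdist j` = block distance at
scale `j`, `D.collar j = R(g_j)M₁ ≥ 0`), satisfying the cell's typed p. 268 rule `B10LargeField.Rule268` («We define the set Ω_{k+1}^{(k)} as a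
union of big blocks of the lattice T₁^{(k)}, with distances to P ∪ Ω_k^{(k)c} greater than R(g_k)M₁»).  If every point of the region `Δ′_j(p′)`
is within block distance `≤ R(g_j)M₁` of a point of `P_j` (`hadj`: the four corner blocks are adjacent to `p′ ∈ P_j` — p. 273 «four j-blocks Δ′
connected with the plaquette p′»), then `Δ′_j(p′)` does not meet `Ω_{j+1}` (`B10LargeField.collar_subset_Z`: the closed collar of `P_j` lies
in `Z_j = Ω_{j+1}ᶜ`). [cite: Balaban1985UV3, pp.267–268, (71) p.273] -/
theorem not_mem_succ_of_rule268 (Ω P : ℕ → Set (Site d)) (bdist : ℕ → Site d → Site d → ℝ)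
    (hb : ∀ j x, bdist j x x = 0) (collar : ℕ → ℝ)
    (hrule : B10LargeField.Rule268 ⟨Site d, Ω, P, bdist, hb, collar⟩)
    {j : ℕ} {R : Finset (Site d)} (hadj : ∀ y ∈ R, ∃ x ∈ P j, bdist j x y ≤ collar j)
    {y : Site d} (hy : y ∈ R) : y ∉ Ω (j + 1) := by
  obtain ⟨x, hx, hxy⟩ := hadj y hy
  exact B10LargeField.collar_subset_Z ⟨Site d, Ω, P, bdist, hb, collar⟩ hrule j x y (Or.inl hx) hxy

/-- **`hin` from the rule.**  Under `Rule268` with `R(g_j)M₁ ≥ 0` the domains are nested ((38), `B10LargeField.nested38_of_rule268`), so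
`Ω_{j′} ⊆ Ω_{j+1}` for `j < j′` (`B10LargeField.Z_mono_le`); hence a region `Δ′_{j′}(p″) ⊆ Ω_{j′}` (`hΩ`: p. 268 (the sentences introducing (48)) «Λ_{k+1} = Ω_{k+1}^{(k+1)}, hence
Ω_{k+1}^{(k)} = B(Λ_{k+1})» — the blocks of `Λ_{j′} ∋ p″` lie in `Ω_{j′}`) lies in `Ω_{j+1}`. [cite: Balaban1985UV3, (38) p.266, (48) p.268] -/
theorem mem_succ_of_rule268 (Ω P : ℕ → Set (Site d)) (bdist : ℕ → Site d → Site d → ℝ)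
    (hb : ∀ j x, bdist j x x = 0) (collar : ℕ → ℝ) (hR : ∀ j, 0 ≤ collar j)
    (hrule : B10LargeField.Rule268 ⟨Site d, Ω, P, bdist, hb, collar⟩)
    {j j' : ℕ} (hjj' : j < j') {y : Site d} (hy : y ∈ Ω j') : y ∈ Ω (j + 1) := by
  set D : B10LargeField.DomainSeq := ⟨Site d, Ω, P, bdist, hb, collar⟩ with hD
  have h38 : B10LargeField.Nested38 D := B10LargeField.nested38_of_rule268 D hR hrule
  by_contra hne
  have hZ : y ∈ B10LargeField.Z D j := hne
  have hZ' : y ∈ B10LargeField.Z D (j' - 1) := B10LargeField.Z_mono_le D h38 (by omega) hZ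
  have hj' : j' - 1 + 1 = j' := by omega
  have : y ∉ Ω (j' - 1 + 1) := hZ'
  rw [hj'] at this
  exact this hy

/-- **Across scales under `Rule268`: every fine plaquette lies in at most FOUR regions `Δ′_j(p′)` over all scales** — `card_filter_scales_le`
with its two inclusions supplied by the cell's typed rule of p. 268 on the fine lattice and the two adjacency readings `hadj` (corner blocks
within the `R(g_j)M₁`-collar of `P_j`) and `hΩ` (`Δ′_{j′}(p″) ⊆ Ω_{j′}`). [cite: Balaban1985UV3, (71) p.273, (38) p.266, pp.267–268] -/
theorem card_filter_scales_le_of_rule268 (Ω P : ℕ → Set (Site d)) (bdist : ℕ → Site d → Site d → ℝ)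
    (hb : ∀ j x, bdist j x x = 0) (collar : ℕ → ℝ) (hR : ∀ j, 0 ≤ collar j)
    (hrule : B10LargeField.Rule268 ⟨Site d, Ω, P, bdist, hb, collar⟩)
    (T : Finset (ℕ × Site d)) (n : ℕ → ℕ) (hn : ∀ i ∈ T, 1 ≤ n i.1) {μ ν : Fin d} (hμν : μ ≠ ν)
    (hadj : ∀ i ∈ T, ∀ y ∈ deltaBox (n i.1) (n i.1 • i.2) μ ν, ∃ x ∈ P i.1, bdist i.1 x y ≤ collar i.1)
    (hΩ : ∀ i ∈ T, ∀ y ∈ deltaBox (n i.1) (n i.1 • i.2) μ ν, y ∈ Ω i.1) (y : Site d) :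
    (T.filter fun i => y ∈ deltaBox (n i.1) (n i.1 • i.2) μ ν).card ≤ 4 :=
  card_filter_scales_le T n hn hμν (fun j => Ω (j + 1))
    (fun i hi _ hy => not_mem_succ_of_rule268 Ω P bdist hb collar hrule (hadj i hi) hy)
    (fun _ _ i' hi' hlt y hy => mem_succ_of_rule268 Ω P bdist hb collar hR hrule hlt (hΩ i' hi' y hy)) y

/-- **(71) FOR ALL LARGE-FIELD PLAQUETTES OF ALL SCALES, `c₁ = ¼`, UNDER THE CELL'S `Rule268`:** with the per-plaquette (71)
`w(j, p′) ≤ c·Σ_{p⊂Δ′_j(p′)} act(p)`, `act ≥ 0` on a finite fine region `Y ⊇ ⋃Δ′`, the p. 268 rule (`B10LargeField.Rule268`, `R(g_j)M₁ ≥ 0`) and the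
two adjacency readings `hadj`/`hΩ`:  **`¼·Σ_{(j,p′)∈T} w(j, p′) ≤ c·Σ_{p∈Y} act(p)`** — `B10LargeFieldSum.SmallFactorsAll`'s inequality with
`c₁ = ¼`, in the Sect.-B / p. 268 vocabulary of the cell (`B10LargeField`). [cite: Balaban1985UV3, (71) p.273, (41) p.266, pp.267–268] -/
theorem quarter_sum_le_of_local71_rule268 (Ω P : ℕ → Set (Site d)) (bdist : ℕ → Site d → Site d → ℝ)
    (hb : ∀ j x, bdist j x x = 0) (collar : ℕ → ℝ) (hR : ∀ j, 0 ≤ collar j)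
    (hrule : B10LargeField.Rule268 ⟨Site d, Ω, P, bdist, hb, collar⟩)
    (T : Finset (ℕ × Site d)) (n : ℕ → ℕ) (hn : ∀ i ∈ T, 1 ≤ n i.1) {μ ν : Fin d} (hμν : μ ≠ ν)
    (hadj : ∀ i ∈ T, ∀ y ∈ deltaBox (n i.1) (n i.1 • i.2) μ ν, ∃ x ∈ P i.1, bdist i.1 x y ≤ collar i.1)
    (hΩ : ∀ i ∈ T, ∀ y ∈ deltaBox (n i.1) (n i.1 • i.2) μ ν, y ∈ Ω i.1)
    (Y : Finset (Site d)) (hY : ∀ i ∈ T, deltaBox (n i.1) (n i.1 • i.2) μ ν ⊆ Y) (act : Site d → ℝ)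
    (hact : ∀ y ∈ Y, 0 ≤ act y) (w : ℕ × Site d → ℝ) {c : ℝ} (hc : 0 ≤ c)
    (h71 : ∀ i ∈ T, w i ≤ c * ∑ y ∈ deltaBox (n i.1) (n i.1 • i.2) μ ν, act y) :
    (1 / 4 : ℝ) * ∑ i ∈ T, w i ≤ c * ∑ y ∈ Y, act y :=
  quarter_sum_le_of_local71_scales T n hn hμν (fun j => Ω (j + 1))
    (fun i hi _ hy => not_mem_succ_of_rule268 Ω P bdist hb collar hrule (hadj i hi) hy)
    (fun _ _ i' hi' hlt y hy => mem_succ_of_rule268 Ω P bdist hb collar hR hrule hlt (hΩ i' hi' y hy)) Y hY act hact w hc h71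

end Rule268

end Literature.MathematicalPhysics.QuantumFieldTheory.Balaban1983to89.B10Eq71AllPlaquettes

end
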